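import Literature.MathematicalPhysics.QuantumFieldTheory.Balaban1983to89.T4ContinuumYM4Torus
import Summits.QuantumFields.BalabanUV.Gaps.EndSurvivorExtension
import Summits.QuantumFields.BalabanUV.Gaps.EndContLetterWitness

/-!
# Gaps / EndSurvivorCensus — (D)'s END criterion and the W-β road with (C), (U), (PS) READ ON THE SURVIVOR SETS ∕ ALONG THE IN-INTERVAL RUNS OF
# LEVEL γ₀ ONLY (Tietze extension in the bare coupling + run equivalence; (D), `Gaps/EndUpperPerLevel`, `EndRunwiseShooting.endpointExistence_of_runwisePS`
# as black boxes), survivor continuity LOAD-BEARING (N-15's staircase), and the census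
# refinement R-38, and §14 AT BAŁABAN's DATUM ∕ AT THE PRINT-FAITHFUL T⁴ HEADLINE (S-47) — a PORT into the tree, with attribution, of g1-plan-2
# GEN 19's lens kernel `HOME/g1/skeletons/XreadHordFadingMemory_plan2.lean` (v1.9 b3bd94734a28a3a0 §14 `SurvivorCensus` second half = v1.10
# 508f7f06226dfbee ∕ v1.11 3364e01583b84190 byte-identical there, + v1.10 §15 `Datum14` ∕ `Headline14`; lens items S-46 ∕ R-38, S-47; offered in
# [G1-PLAN2-G19-XREAD-PA-PD] ∕ [G1-PLAN2-G19-S47])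
# (cell pub-balaban-gaps, seat g1-p3 gen 7, row CAP+tail ∕ β-currency «split ∕ weakening»; file 8 of «the binder census of the END roads»; imports the
# witness leaf `Gaps/EndContLetterWitness` for the consistency theorem)

HONEST FRAMING (cell rule, page 1 of everything): [folklore] real analysis (Tietze–Urysohn on a closed subset of the normal space `]0,γ₀]`) over
the tree's typed carriers (`FlowStep.HBeta` ∕ `Y` ∕ `gClamp` ∕ `clampPrefix` ∕ `RGEqH`, `FlowStepRuns`, `DagBinding.ForwardGenerated` ∕ `EndpointExistence`
∕ `modelOf`, `EndRunwiseShooting.survives_of_run` ∕ `Y_eq_of_run` ∕ `endpointExistence_of_runwisePS`).  AUTHORSHIP: the mathematics and the Lean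
text of every declaration below are g1-plan-2 GEN 19's (planner seat; planners file nothing on the ledger by mandate — «provers may port», offered in
[G1-PLAN2-G19-XREAD-PA-PD] ∕ [G1-PLAN2-G19-XREAD-A1-SIX]); this seat's contribution is the port (namespace, imports, this header, one added docstring,
two references re-pointed to the tree's leaves) and the kernel re-check against the tree.  Every β-side hypothesis (survivor continuity, survivor
bounds, run-wise (PS), non-crossing) is a BINDER (a hypothesis SHAPE); for Bałaban's β continuity in the coupling is ASSERTED in print ([I] §1
pp. 263–264; no located proof — GAPS G-adv2-3 ∕ G-adv2-6), so NO word of record moves.  `EndpointExistence` appears only as a conclusion of ∕ inside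
an equivalence with hypotheses named in the signature.  NOTHING of Bałaban's is asserted; 0∕6 binders; 0 coefficients certified; one finite T⁴;
NOT B12 Thm 2, NOT `BetaPertH`, NOT the continuum limit, NOT Clay.

THE POINT (g1-plan-2 S-46 ∕ R-38, verbatim in substance).  If each trace `x ↦ β_k(clampPrefix β γ₀ k x)` is continuous ON `S_k` and bounded above ON
`S_k` (uniformly by `β′ ≥ 0`, or per level), then — `S_k` being closed in `]0,γ₀]` — Tietze extends the traces to a table `F` continuous and bounded on
all of `]0,γ₀]` (`Gaps/EndSurvivorExtension`), the extension family `extH F` has THE SAME IN-INTERVAL RUNS at every level `≤ γ₀` as `β`, hence the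
same `hord`, the same run-wise (PS), the same top-run data and the same END binder.  CONSEQUENCES (construction level; `HaltsOutside` + `CurriesHBeta`
for the iff, `ForwardGenerated` only for the W-β roads): **`endpointExistence_iff_topRuns_survCont`** ((D)'s criterion from {`0 < γ₀`, `0 ≤ β′`, survivor
continuity, survivor bound `β′`, `hord`}), **`endpointExistence_iff_topRuns_survivors_locUpper`** (per-level survivor bounds, no sign binder),
**`endpointExistence_of_survivorLetters_runwisePS`** ∕ `_locUpper` (survivor continuity + survivor bound(s) + RUN-WISE (PS) at level γ₀ ⟹ END),
`endpointExistence_modelOf_iff_topRuns_survCont`; survivor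
letters ⟸ foliation letters ⟸ box letters (`survCont_of_folCont`, `survCont_of_betaContH`, `survUpper_of_folUpper`, `survLocUpper_of_folLocUpper`);
**`not_survCont_betaJ`** (N-15's staircase violates survivor continuity at every level — DERIVED from the criterion: survivor continuity is
LOAD-BEARING on the order roads); **`contLetter_survivor_census`** (R-38: the (C) ∕ (U) ∕ (PS) columns of the binder census read «on the survivor sets ∕
along the in-interval runs of level γ₀; everything else SPARE»).  BEARING (the author's located remark, NOT an ask): binder B4 `hC` of the T⁴ headline
is needed by the END roads only as continuity, in the bare coupling, of countably many one-variable functions on the closed sets of couplings whose runs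
survive `k` steps — made a theorem AT THE DATUM and AT THE HEADLINE in §3 (S-47): `endpointExistence_datum_of_survivorLetters_runwisePS`,
`endpointExistence_datum_iff_topRuns_survivors` (`D.fwd`, `D.curries` fields; `HaltsOutside` a hypothesis), **`continuumYM4_torus_of_survivorLetters_runwisePS`**
∕ `_topRuns` (= `continuumYM4_torus_of_endpointExistence_nonvacuous` BY NAME: printed-averaged datum on SU(N), (B), the survivor letters of `D.βfun`, the
spine slot ⟹ `ContinuumYM4Torus D ∧ ContinuumYM4TorusE D`).
0 sorry; 0 def; imports `T4ContinuumYM4Torus` + `Gaps/EndSurvivorExtension` + `Gaps/EndContLetterWitness` (toy family `betaJ` for the consistency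
theorem); restates nothing.

CITATION HEADER (tags CONTEXT ONLY).  [I] = T. Bałaban, Commun. Math. Phys. **109** (1987) [Balaban1987RG1]: Thm 2 p. 259, (0.20) p. 256,
§1 pp. 263–264.
-/

namespace Summit.QuantumFields.BalabanUV.Gaps.EndSurvivorCensus

open Literature.MathematicalPhysics.QuantumFieldTheory.Balaban1983to89
open Literature.MathematicalPhysics.QuantumFieldTheory.Balaban1983to89.FlowStep
open Literature.MathematicalPhysics.QuantumFieldTheory.Balaban1983to89.FlowStepRuns
open Literature.MathematicalPhysics.QuantumFieldTheory.Balaban1983to89.DagBinding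
open Summit.QuantumFields.BalabanUV.Gaps.EndRunwiseShooting
open Summit.QuantumFields.BalabanUV.Gaps.EndTopRunCriterion
open Summit.QuantumFields.BalabanUV.Gaps.EndUpperPerLevel
open Summit.QuantumFields.BalabanUV.Gaps.EndContAlongFoliation
open Literature.MathematicalPhysics.QuantumFieldTheory.Balaban1983to89.T4Continuum
open Literature.MathematicalPhysics.QuantumFieldTheory.Balaban1983to89.T4ContinuumYM4Torus
open Topology Finset
open Summit.QuantumFields.BalabanUV.Gaps.EndContLetterWitness
open Summit.QuantumFields.BalabanUV.Gaps.EndSurvivorExtension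

universe u

noncomputable section

/-! ## §1 (D)'s criterion and the W-β road with the letters on the survivor sets (g1-plan-2 kernel §14, second half, ported) -/

/-- **(D)'s END CRITERION WITH THE LETTERS READ ON THE SURVIVOR SETS ONLY** (construction level; uniform bound `β′ ≥ 0`). [folklore] -/
theorem endpointExistence_iff_topRuns_survCont {C : B12.Construction} {β : HBeta} (hgen : ForwardGenerated C β)
    (hhalt : HaltsOutside C β) (hcur : CurriesHBeta C β) {γ₀ β' : ℝ} (hγ₀ : 0 < γ₀) (hβ' : 0 ≤ β')
    (hsc : ∀ k : ℕ, ContinuousOn (fun x : ℝ => β k (clampPrefix β γ₀ k x))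
      {x : ℝ | 0 < x ∧ x ≤ γ₀ ∧ ∀ j, j ≤ k → 1 / γ₀ ^ 2 ≤ Y β γ₀ j x})
    (hsu : ∀ (k : ℕ) (x : ℝ), 0 < x → x ≤ γ₀ → (∀ j, j ≤ k → 1 / γ₀ ^ 2 ≤ Y β γ₀ j x) →
      β k (clampPrefix β γ₀ k x) ≤ β')
    (hord : ∀ γ : ℝ, 0 < γ → γ ≤ γ₀ → ∀ (n : ℕ) (gs gs' : ℕ → ℝ), RGEqH n β gs → RGEqH n β gs' →
      Step.InInterval γ n gs → Step.InInterval γ n gs' → gs 0 < gs' 0 → ∀ k, k ≤ n → gs k < gs' k) :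
    EndpointExistence C ↔
      ∃ γ₂ : ℝ, 0 < γ₂ ∧ ∀ γ : ℝ, 0 < γ → γ ≤ γ₂ → ∃ gstar : ℝ, 0 < gstar ∧
        ∀ (n : ℕ) (gs : ℕ → ℝ), RGEqH n β gs → Step.InInterval γ n gs → ∀ k, k ≤ n → gs k = γ → gstar ≤ gs n := by
  obtain ⟨F, hFc, hFu, hagree⟩ := exists_extension_of_survivorLetters (B := fun _ => β') hsc hsu
  have hD := endpointExistence_modelOf_iff_topRuns hγ₀ hβ' (betaContH_extH hFc) (betaUpperH_extH hFu) (hord_extH hagree hord)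
  have h1 : ∀ γ : ℝ, 0 < γ → γ ≤ γ₀ → ∀ (n : ℕ) (gs : ℕ → ℝ), Step.InInterval γ n gs → RGEqH n β gs → RGEqH n (extH F) gs :=
    fun _ _ hγle _ _ hI hrg => rgEqH_extH_of_rgEqH hγle hagree hrg hI
  have h2 : ∀ γ : ℝ, 0 < γ → γ ≤ γ₀ → ∀ (n : ℕ) (gs : ℕ → ℝ), Step.InInterval γ n gs → RGEqH n (extH F) gs → RGEqH n β gs :=
    fun _ _ hγle _ _ hI hrg => rgEqH_of_rgEqH_extH hγle hagree hrg hI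
  constructor
  · intro hE
    exact topRuns_of_runs hγ₀ h1 (hD.1 (endpointExistence_of_runs hγ₀ hgen hhalt hcur (modelOf_forwardGenerated _) h1 hE))
  · intro htop
    exact endpointExistence_of_runs hγ₀ (modelOf_forwardGenerated _) (modelOf_haltsOutside _) (modelOf_curries _) hgen h2
      (hD.2 (topRuns_of_runs hγ₀ h2 htop))

/-- **THE W-β ROAD WITH EVERY LETTER ON THE SURVIVOR SETS ∕ RUNS** (construction level; `ForwardGenerated` only): traces continuous on the
survivor sets, `≤ β′` there (`β′ ≥ 0`), and (PS) along the in-interval runs of level γ₀ ⟹ END. [folklore] -/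
theorem endpointExistence_of_survivorLetters_runwisePS {C : B12.Construction} {β : HBeta} (hgen : ForwardGenerated C β)
    {γ₀ M β' : ℝ} (hγ₀ : 0 < γ₀) (hM : 0 ≤ M) (hβ' : 0 ≤ β')
    (hsc : ∀ k : ℕ, ContinuousOn (fun x : ℝ => β k (clampPrefix β γ₀ k x))
      {x : ℝ | 0 < x ∧ x ≤ γ₀ ∧ ∀ j, j ≤ k → 1 / γ₀ ^ 2 ≤ Y β γ₀ j x})
    (hsu : ∀ (k : ℕ) (x : ℝ), 0 < x → x ≤ γ₀ → (∀ j, j ≤ k → 1 / γ₀ ^ 2 ≤ Y β γ₀ j x) →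
      β k (clampPrefix β γ₀ k x) ≤ β')
    (hrun : ∀ (n : ℕ) (gs : ℕ → ℝ), RGEqH n β gs → Step.InInterval γ₀ n gs →
      ∀ k, k ≤ n → -M ≤ ∑ j ∈ Finset.Ico k n, β j (prefixOf gs j)) :
    EndpointExistence C := by
  obtain ⟨F, hFc, hFu, hagree⟩ := exists_extension_of_survivorLetters (B := fun _ => β') hsc hsu
  exact endpointExistence_of_runs hγ₀ (modelOf_forwardGenerated _) (modelOf_haltsOutside _) (modelOf_curries _) hgen
    (fun _ _ hγle _ _ hI hrg => rgEqH_of_rgEqH_extH hγle hagree hrg hI)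
    (endpointExistence_of_runwisePS (modelOf_forwardGenerated (extH F)) hγ₀ hM hβ' (betaContH_extH hFc)
      (betaUpperH_extH hFu) (runwisePS_extH hagree hrun))

/-- … and with PER-LEVEL bounds on the survivor sets (no `β′`, no `0 ≤ β′`). [folklore] -/
theorem endpointExistence_of_survivorLetters_runwisePS_locUpper {C : B12.Construction} {β : HBeta} (hgen : ForwardGenerated C β)
    {γ₀ M : ℝ} (hγ₀ : 0 < γ₀) (hM : 0 ≤ M)
    (hsc : ∀ k : ℕ, ContinuousOn (fun x : ℝ => β k (clampPrefix β γ₀ k x))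
      {x : ℝ | 0 < x ∧ x ≤ γ₀ ∧ ∀ j, j ≤ k → 1 / γ₀ ^ 2 ≤ Y β γ₀ j x})
    (hsl : ∀ k : ℕ, ∃ B : ℝ, ∀ x : ℝ, 0 < x → x ≤ γ₀ → (∀ j, j ≤ k → 1 / γ₀ ^ 2 ≤ Y β γ₀ j x) →
      β k (clampPrefix β γ₀ k x) ≤ B)
    (hrun : ∀ (n : ℕ) (gs : ℕ → ℝ), RGEqH n β gs → Step.InInterval γ₀ n gs →
      ∀ k, k ≤ n → -M ≤ ∑ j ∈ Finset.Ico k n, β j (prefixOf gs j)) :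
    EndpointExistence C := by
  choose B hB using hsl
  obtain ⟨F, hFc, hFu, hagree⟩ := exists_extension_of_survivorLetters (B := B) hsc hB
  exact endpointExistence_of_runs hγ₀ (modelOf_forwardGenerated _) (modelOf_haltsOutside _) (modelOf_curries _) hgen
    (fun _ _ hγle _ _ hI hrg => rgEqH_of_rgEqH_extH hγle hagree hrg hI)
    (endpointExistence_of_runwisePS_locUpper (modelOf_forwardGenerated (extH F)) hγ₀ hM (betaContH_extH hFc)
      (perLevelUpper_extH fun k => ⟨B k, hFu k⟩) (runwisePS_extH hagree hrun))

/-- The same for the canonical construction `modelOf β`: (D)'s `endpointExistence_modelOf_iff_topRuns` with (C) and (U) ON THE SURVIVOR SETS. [folklore] -/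
theorem endpointExistence_modelOf_iff_topRuns_survCont {β : HBeta} {γ₀ β' : ℝ} (hγ₀ : 0 < γ₀) (hβ' : 0 ≤ β')
    (hsc : ∀ k : ℕ, ContinuousOn (fun x : ℝ => β k (clampPrefix β γ₀ k x))
      {x : ℝ | 0 < x ∧ x ≤ γ₀ ∧ ∀ j, j ≤ k → 1 / γ₀ ^ 2 ≤ Y β γ₀ j x})
    (hsu : ∀ (k : ℕ) (x : ℝ), 0 < x → x ≤ γ₀ → (∀ j, j ≤ k → 1 / γ₀ ^ 2 ≤ Y β γ₀ j x) →
      β k (clampPrefix β γ₀ k x) ≤ β')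
    (hord : ∀ γ : ℝ, 0 < γ → γ ≤ γ₀ → ∀ (n : ℕ) (gs gs' : ℕ → ℝ), RGEqH n β gs → RGEqH n β gs' →
      Step.InInterval γ n gs → Step.InInterval γ n gs' → gs 0 < gs' 0 → ∀ k, k ≤ n → gs k < gs' k) :
    EndpointExistence (modelOf β) ↔
      ∃ γ₂ : ℝ, 0 < γ₂ ∧ ∀ γ : ℝ, 0 < γ → γ ≤ γ₂ → ∃ gstar : ℝ, 0 < gstar ∧
        ∀ (n : ℕ) (gs : ℕ → ℝ), RGEqH n β gs → Step.InInterval γ n gs → ∀ k, k ≤ n → gs k = γ → gstar ≤ gs n :=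
  endpointExistence_iff_topRuns_survCont (modelOf_forwardGenerated β) (modelOf_haltsOutside β) (modelOf_curries β) hγ₀ hβ' hsc hsu hord

/-- **… AND WITH PER-LEVEL BOUNDS ON THE SURVIVOR SETS** (`EndUpperPerLevel.endpointExistence_modelOf_iff_topRuns_locUpper` as the black box): (D)'s
construction-level criterion from {`0 < γ₀`, continuity of each trace on `S_k`, a bound `B_k` of each trace on `S_k`, non-crossing}. [folklore] -/
theorem endpointExistence_iff_topRuns_survivors_locUpper {C : B12.Construction} {β : HBeta} (hgen : ForwardGenerated C β)
    (hhalt : HaltsOutside C β) (hcur : CurriesHBeta C β) {γ₀ : ℝ} (hγ₀ : 0 < γ₀)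
    (hsc : ∀ k : ℕ, ContinuousOn (fun x : ℝ => β k (clampPrefix β γ₀ k x))
      {x : ℝ | 0 < x ∧ x ≤ γ₀ ∧ ∀ j, j ≤ k → 1 / γ₀ ^ 2 ≤ Y β γ₀ j x})
    (hsl : ∀ k : ℕ, ∃ B : ℝ, ∀ x : ℝ, 0 < x → x ≤ γ₀ → (∀ j, j ≤ k → 1 / γ₀ ^ 2 ≤ Y β γ₀ j x) →
      β k (clampPrefix β γ₀ k x) ≤ B)
    (hord : ∀ γ : ℝ, 0 < γ → γ ≤ γ₀ → ∀ (n : ℕ) (gs gs' : ℕ → ℝ), RGEqH n β gs → RGEqH n β gs' →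
      Step.InInterval γ n gs → Step.InInterval γ n gs' → gs 0 < gs' 0 → ∀ k, k ≤ n → gs k < gs' k) :
    EndpointExistence C ↔
      ∃ γ₂ : ℝ, 0 < γ₂ ∧ ∀ γ : ℝ, 0 < γ → γ ≤ γ₂ → ∃ gstar : ℝ, 0 < gstar ∧
        ∀ (n : ℕ) (gs : ℕ → ℝ), RGEqH n β gs → Step.InInterval γ n gs → ∀ k, k ≤ n → gs k = γ → gstar ≤ gs n := by
  choose B hB using hsl
  obtain ⟨F, hFc, hFu, hagree⟩ := exists_extension_of_survivorLetters (B := B) hsc hB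
  have hD := endpointExistence_modelOf_iff_topRuns_locUpper hγ₀ (betaContH_extH hFc) (perLevelUpper_extH fun k => ⟨B k, hFu k⟩)
    (hord_extH hagree hord)
  have h1 : ∀ γ : ℝ, 0 < γ → γ ≤ γ₀ → ∀ (n : ℕ) (gs : ℕ → ℝ), Step.InInterval γ n gs → RGEqH n β gs → RGEqH n (extH F) gs :=
    fun _ _ hγle _ _ hI hrg => rgEqH_extH_of_rgEqH hγle hagree hrg hI
  have h2 : ∀ γ : ℝ, 0 < γ → γ ≤ γ₀ → ∀ (n : ℕ) (gs : ℕ → ℝ), Step.InInterval γ n gs → RGEqH n (extH F) gs → RGEqH n β gs :=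
    fun _ _ hγle _ _ hI hrg => rgEqH_of_rgEqH_extH hγle hagree hrg hI
  constructor
  · intro hE
    exact topRuns_of_runs hγ₀ h1 (hD.1 (endpointExistence_of_runs hγ₀ hgen hhalt hcur (modelOf_forwardGenerated _) h1 hE))
  · intro htop
    exact endpointExistence_of_runs hγ₀ (modelOf_forwardGenerated _) (modelOf_haltsOutside _) (modelOf_curries _) hgen h2
      (hD.2 (topRuns_of_runs hγ₀ h2 htop))

/-! ## §2 Survivor letters ⟸ foliation letters ⟸ box letters; consistency with N-15; the census refinement R-38 (kernel §14, ported) -/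

/-- Continuity along the whole foliation (`Gaps/EndContAlongFoliation`) gives continuity on the survivor sets. [folklore] -/
theorem survCont_of_folCont {β : HBeta} {γ₀ : ℝ}
    (hfol : ∀ k : ℕ, ContinuousOn (fun x : ℝ => β k (clampPrefix β γ₀ k x)) (Set.Ioc 0 γ₀)) :
    ∀ k : ℕ, ContinuousOn (fun x : ℝ => β k (clampPrefix β γ₀ k x))
      {x : ℝ | 0 < x ∧ x ≤ γ₀ ∧ ∀ j, j ≤ k → 1 / γ₀ ^ 2 ≤ Y β γ₀ j x} :=
  fun k => (hfol k).mono fun _ hx => ⟨hx.1, hx.2.1⟩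

/-- (C) on the boxes gives continuity on the survivor sets. [folklore] -/
theorem survCont_of_betaContH {β : HBeta} {γ₀ : ℝ} (hγ₀ : 0 < γ₀) (hcont : BetaContH γ₀ β) :
    ∀ k : ℕ, ContinuousOn (fun x : ℝ => β k (clampPrefix β γ₀ k x))
      {x : ℝ | 0 < x ∧ x ≤ γ₀ ∧ ∀ j, j ≤ k → 1 / γ₀ ^ 2 ≤ Y β γ₀ j x} :=
  survCont_of_folCont (folCont_of_betaContH hγ₀ hcont)

/-- A bound along the foliation (in particular (U) on the boxes, `folUpper_of_betaUpperH`) gives the bound on the survivor sets. [folklore] -/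
theorem survUpper_of_folUpper {β : HBeta} {γ₀ β' : ℝ}
    (hhiFol : ∀ (k : ℕ) (x : ℝ), 0 < x → x ≤ γ₀ → β k (clampPrefix β γ₀ k x) ≤ β') :
    ∀ (k : ℕ) (x : ℝ), 0 < x → x ≤ γ₀ → (∀ j, j ≤ k → 1 / γ₀ ^ 2 ≤ Y β γ₀ j x) →
      β k (clampPrefix β γ₀ k x) ≤ β' :=
  fun k x hx hxγ _ => hhiFol k x hx hxγ

/-- Per-level bounds along the foliation give per-level bounds on the survivor sets. [folklore] -/
theorem survLocUpper_of_folLocUpper {β : HBeta} {γ₀ : ℝ}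
    (hlocFol : ∀ k : ℕ, ∃ B : ℝ, ∀ x : ℝ, 0 < x → x ≤ γ₀ → β k (clampPrefix β γ₀ k x) ≤ B) :
    ∀ k : ℕ, ∃ B : ℝ, ∀ x : ℝ, 0 < x → x ≤ γ₀ → (∀ j, j ≤ k → 1 / γ₀ ^ 2 ≤ Y β γ₀ j x) →
      β k (clampPrefix β γ₀ k x) ≤ B :=
  fun k => (hlocFol k).imp fun _ hB x hx hxγ _ => hB x hx hxγ

/-- CONSISTENCY WITH N-15 (`Gaps/EndContLetterWitness`), DERIVED from the new criterion: the floor-staircase family `betaJ` (every order letter,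
(U), top-runs at every level, NO `EndpointExistence`) violates survivor continuity at every level `γ₀ > 0` (directly: `S_0 = ]0,γ₀]` and the `k = 0` trace is
`x ↦ stair x`).  Survivor continuity is LOAD-BEARING on the order roads. [folklore] -/
theorem not_survCont_betaJ {γ₀ : ℝ} (hγ₀ : 0 < γ₀) :
    ¬ ∀ k : ℕ, ContinuousOn (fun x : ℝ => betaJ k (clampPrefix betaJ γ₀ k x))
      {x : ℝ | 0 < x ∧ x ≤ γ₀ ∧ ∀ j, j ≤ k → 1 / γ₀ ^ 2 ≤ Y betaJ γ₀ j x} := fun hsc =>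
  not_endpointExistence_betaJ ((endpointExistence_modelOf_iff_topRuns_survCont hγ₀ zero_le_one hsc
    (survUpper_of_folUpper (folUpper_of_betaUpperH hγ₀ (betaUpperH_betaJ γ₀))) hord_betaJ).mpr topRunCriterion_betaJ)

/-- **R-38 (census refinement of R-37, reformulation of record, zero weight) — THE LETTERS ON THE SURVIVOR SETS.**  (i) (D)'s criterion holds
with continuity and a uniform bound `β′ ≥ 0` of the traces ON THE SURVIVOR SETS in place of (C) and (U); (ii) the same with per-level survivor
bounds and no sign binder; (iii) the W-β road holds from survivor continuity, per-level survivor bounds and RUN-WISE (PS); (iv) the survivor set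
`S_k` is the set of initial couplings of the in-interval runs of length `k`; (v) survivor continuity is load-bearing (N-15's witness violates it
at every level, has `hord` at every level and no END); (vi) the foliation letters of `Gaps/EndContAlongFoliation` (hence the box letters) imply the
survivor letters. [folklore] -/
theorem contLetter_survivor_census :
    (∀ (β : HBeta) (γ₀ β' : ℝ), 0 < γ₀ → 0 ≤ β' →
        (∀ k : ℕ, ContinuousOn (fun x : ℝ => β k (clampPrefix β γ₀ k x))
          {x : ℝ | 0 < x ∧ x ≤ γ₀ ∧ ∀ j, j ≤ k → 1 / γ₀ ^ 2 ≤ Y β γ₀ j x}) →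
        (∀ (k : ℕ) (x : ℝ), 0 < x → x ≤ γ₀ → (∀ j, j ≤ k → 1 / γ₀ ^ 2 ≤ Y β γ₀ j x) →
          β k (clampPrefix β γ₀ k x) ≤ β') →
        (∀ γ : ℝ, 0 < γ → γ ≤ γ₀ → ∀ (n : ℕ) (gs gs' : ℕ → ℝ), RGEqH n β gs → RGEqH n β gs' →
          Step.InInterval γ n gs → Step.InInterval γ n gs' → gs 0 < gs' 0 → ∀ k, k ≤ n → gs k < gs' k) →
        (EndpointExistence (modelOf β) ↔
          ∃ γ₂ : ℝ, 0 < γ₂ ∧ ∀ γ : ℝ, 0 < γ → γ ≤ γ₂ → ∃ gstar : ℝ, 0 < gstar ∧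
            ∀ (n : ℕ) (gs : ℕ → ℝ), RGEqH n β gs → Step.InInterval γ n gs → ∀ k, k ≤ n → gs k = γ → gstar ≤ gs n)) ∧
    (∀ (β : HBeta) (γ₀ : ℝ), 0 < γ₀ →
        (∀ k : ℕ, ContinuousOn (fun x : ℝ => β k (clampPrefix β γ₀ k x))
          {x : ℝ | 0 < x ∧ x ≤ γ₀ ∧ ∀ j, j ≤ k → 1 / γ₀ ^ 2 ≤ Y β γ₀ j x}) →
        (∀ k : ℕ, ∃ B : ℝ, ∀ x : ℝ, 0 < x → x ≤ γ₀ → (∀ j, j ≤ k → 1 / γ₀ ^ 2 ≤ Y β γ₀ j x) →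
          β k (clampPrefix β γ₀ k x) ≤ B) →
        (∀ γ : ℝ, 0 < γ → γ ≤ γ₀ → ∀ (n : ℕ) (gs gs' : ℕ → ℝ), RGEqH n β gs → RGEqH n β gs' →
          Step.InInterval γ n gs → Step.InInterval γ n gs' → gs 0 < gs' 0 → ∀ k, k ≤ n → gs k < gs' k) →
        (EndpointExistence (modelOf β) ↔
          ∃ γ₂ : ℝ, 0 < γ₂ ∧ ∀ γ : ℝ, 0 < γ → γ ≤ γ₂ → ∃ gstar : ℝ, 0 < gstar ∧
            ∀ (n : ℕ) (gs : ℕ → ℝ), RGEqH n β gs → Step.InInterval γ n gs → ∀ k, k ≤ n → gs k = γ → gstar ≤ gs n)) ∧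
    (∀ (β : HBeta) (γ₀ M : ℝ), 0 < γ₀ → 0 ≤ M →
        (∀ k : ℕ, ContinuousOn (fun x : ℝ => β k (clampPrefix β γ₀ k x))
          {x : ℝ | 0 < x ∧ x ≤ γ₀ ∧ ∀ j, j ≤ k → 1 / γ₀ ^ 2 ≤ Y β γ₀ j x}) →
        (∀ k : ℕ, ∃ B : ℝ, ∀ x : ℝ, 0 < x → x ≤ γ₀ → (∀ j, j ≤ k → 1 / γ₀ ^ 2 ≤ Y β γ₀ j x) →
          β k (clampPrefix β γ₀ k x) ≤ B) →
        (∀ (n : ℕ) (gs : ℕ → ℝ), RGEqH n β gs → Step.InInterval γ₀ n gs →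
          ∀ k, k ≤ n → -M ≤ ∑ j ∈ Finset.Ico k n, β j (prefixOf gs j)) →
        EndpointExistence (modelOf β)) ∧
    (∀ (β : HBeta) (γ₀ : ℝ), 0 < γ₀ → ∀ (k : ℕ) (x : ℝ),
        (0 < x ∧ x ≤ γ₀ ∧ ∀ j, j ≤ k → 1 / γ₀ ^ 2 ≤ Y β γ₀ j x) ↔
          ∃ gs : ℕ → ℝ, gs 0 = x ∧ RGEqH k β gs ∧ Step.InInterval γ₀ k gs) ∧
    (∃ β : HBeta, ¬ EndpointExistence (modelOf β) ∧
        (∀ γ₀ : ℝ, ∀ γ : ℝ, 0 < γ → γ ≤ γ₀ → ∀ (n : ℕ) (gs gs' : ℕ → ℝ), RGEqH n β gs → RGEqH n β gs' →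
          Step.InInterval γ n gs → Step.InInterval γ n gs' → gs 0 < gs' 0 → ∀ k, k ≤ n → gs k < gs' k) ∧
        ∀ γ₀ : ℝ, 0 < γ₀ → ¬ ∀ k : ℕ, ContinuousOn (fun x : ℝ => β k (clampPrefix β γ₀ k x))
          {x : ℝ | 0 < x ∧ x ≤ γ₀ ∧ ∀ j, j ≤ k → 1 / γ₀ ^ 2 ≤ Y β γ₀ j x}) ∧
    (∀ (β : HBeta) (γ₀ : ℝ),
        (∀ k : ℕ, ContinuousOn (fun x : ℝ => β k (clampPrefix β γ₀ k x)) (Set.Ioc 0 γ₀)) →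
        ∀ k : ℕ, ContinuousOn (fun x : ℝ => β k (clampPrefix β γ₀ k x))
          {x : ℝ | 0 < x ∧ x ≤ γ₀ ∧ ∀ j, j ≤ k → 1 / γ₀ ^ 2 ≤ Y β γ₀ j x}) :=
  ⟨fun _ _ _ hγ₀ hβ' hsc hsu hord => endpointExistence_modelOf_iff_topRuns_survCont hγ₀ hβ' hsc hsu hord,
   fun _ _ hγ₀ hsc hsl hord => endpointExistence_iff_topRuns_survivors_locUpper (modelOf_forwardGenerated _) (modelOf_haltsOutside _)
      (modelOf_curries _) hγ₀ hsc hsl hord,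
   fun _ _ _ hγ₀ hM hsc hsl hrun => endpointExistence_of_survivorLetters_runwisePS_locUpper (modelOf_forwardGenerated _) hγ₀ hM hsc hsl hrun,
   fun _ _ hγ₀ k x => survivor_iff_run hγ₀ k x,
   ⟨betaJ, not_endpointExistence_betaJ, fun _ => hord_betaJ, fun _ hγ₀ => not_survCont_betaJ hγ₀⟩,
   fun _ _ => survCont_of_folCont⟩

/-! ## §3 At Bałaban's datum and at the print-faithful T⁴ headline: the β-letters read on the survivor sets (g1-plan-2 kernel v1.10 §15, S-47, ported) -/

section Datum

variable {F : T4Family} {G : Type u} [GaugeGroup G] [MeasurableSpace G] [HaarData G]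

/-- **END OF THE DATUM FROM THE SURVIVOR LETTERS, W-β ROAD** (no `HaltsOutside` needed): survivor continuity + per-level survivor bounds +
RUN-WISE (PS) at level γ₀ for `D.βfun` ⟹ `DagBinding.EndpointExistence D.C.toB12`. [folklore] -/
theorem endpointExistence_datum_of_survivorLetters_runwisePS (D : FiniteEpsData F G) {γ₀ M : ℝ} (hγ₀ : 0 < γ₀) (hM : 0 ≤ M)
    (hsc : ∀ k : ℕ, ContinuousOn (fun x : ℝ => D.βfun k (clampPrefix D.βfun γ₀ k x))
      {x : ℝ | 0 < x ∧ x ≤ γ₀ ∧ ∀ j, j ≤ k → 1 / γ₀ ^ 2 ≤ Y D.βfun γ₀ j x})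
    (hsl : ∀ k : ℕ, ∃ B : ℝ, ∀ x : ℝ, 0 < x → x ≤ γ₀ → (∀ j, j ≤ k → 1 / γ₀ ^ 2 ≤ Y D.βfun γ₀ j x) →
      D.βfun k (clampPrefix D.βfun γ₀ k x) ≤ B)
    (hrun : ∀ (n : ℕ) (gs : ℕ → ℝ), RGEqH n D.βfun gs → Step.InInterval γ₀ n gs →
      ∀ k, k ≤ n → -M ≤ ∑ j ∈ Finset.Ico k n, D.βfun j (prefixOf gs j)) :
    EndpointExistence D.C.toB12 :=
  endpointExistence_of_survivorLetters_runwisePS_locUpper D.fwd hγ₀ hM hsc hsl hrun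

/-- **END OF THE DATUM ⟺ TOP-RUNS FROM THE SURVIVOR LETTERS, ORDER ROAD** (with `HaltsOutside` granted, as in `Gaps/EndRunwiseHeadline`): survivor continuity +
per-level survivor bounds + `hord` ⟹ (`EndpointExistence D.C.toB12 ⟺` top-runs of `D.βfun`). [folklore] -/
theorem endpointExistence_datum_iff_topRuns_survivors (D : FiniteEpsData F G) (hhalt : HaltsOutside D.C.toB12 D.βfun)
    {γ₀ : ℝ} (hγ₀ : 0 < γ₀)
    (hsc : ∀ k : ℕ, ContinuousOn (fun x : ℝ => D.βfun k (clampPrefix D.βfun γ₀ k x))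
      {x : ℝ | 0 < x ∧ x ≤ γ₀ ∧ ∀ j, j ≤ k → 1 / γ₀ ^ 2 ≤ Y D.βfun γ₀ j x})
    (hsl : ∀ k : ℕ, ∃ B : ℝ, ∀ x : ℝ, 0 < x → x ≤ γ₀ → (∀ j, j ≤ k → 1 / γ₀ ^ 2 ≤ Y D.βfun γ₀ j x) →
      D.βfun k (clampPrefix D.βfun γ₀ k x) ≤ B)
    (hord : ∀ γ : ℝ, 0 < γ → γ ≤ γ₀ → ∀ (n : ℕ) (gs gs' : ℕ → ℝ), RGEqH n D.βfun gs → RGEqH n D.βfun gs' →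
      Step.InInterval γ n gs → Step.InInterval γ n gs' → gs 0 < gs' 0 → ∀ k, k ≤ n → gs k < gs' k) :
    EndpointExistence D.C.toB12 ↔
      ∃ γ₂ : ℝ, 0 < γ₂ ∧ ∀ γ : ℝ, 0 < γ → γ ≤ γ₂ → ∃ gstar : ℝ, 0 < gstar ∧
        ∀ (n : ℕ) (gs : ℕ → ℝ), RGEqH n D.βfun gs → Step.InInterval γ n gs → ∀ k, k ≤ n → gs k = γ → gstar ≤ gs n :=
  endpointExistence_iff_topRuns_survivors_locUpper D.fwd hhalt D.curries hγ₀ hsc hsl hord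

end Datum

section DatumSU


variable {F : T4Family} {N : ℕ} [NeZero N]

/-- **THE PRINT-FAITHFUL T⁴ HEADLINE WITH THE β-LETTERS READ ON THE SURVIVOR SETS (W-β road), BOTH READINGS.**  Printed-averaged datum on
`SU(N)`; binders: (B), survivor continuity + per-level survivor bounds + run-wise (PS) at level γ₀ of `D.βfun`, and the spine slot under the
END binder; conclusion `ContinuumYM4Torus D ∧ ContinuumYM4TorusE D` (= `continuumYM4_torus_of_endpointExistence_nonvacuous` ∘ `EndSurvivorCensus`).
No (C) box binder, no (U) uniform binder, no (PS) box binder.  Decides nothing (0∕6; one finite T⁴; NOT Clay). [cite: Balaban1987RG1, Thm 2 p.259] -/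
theorem continuumYM4_torus_of_survivorLetters_runwisePS (D : FiniteEpsData F (Matrix.specialUnitaryGroup (Fin N) ℂ))
    (hD : D.IsPrintedAveraged) (hB : B16.EndStatementBPrinted D.C) {γ₀ M : ℝ} (hγ₀ : 0 < γ₀) (hM : 0 ≤ M)
    (hsc : ∀ k : ℕ, ContinuousOn (fun x : ℝ => D.βfun k (clampPrefix D.βfun γ₀ k x))
      {x : ℝ | 0 < x ∧ x ≤ γ₀ ∧ ∀ j, j ≤ k → 1 / γ₀ ^ 2 ≤ Y D.βfun γ₀ j x})
    (hsl : ∀ k : ℕ, ∃ B : ℝ, ∀ x : ℝ, 0 < x → x ≤ γ₀ → (∀ j, j ≤ k → 1 / γ₀ ^ 2 ≤ Y D.βfun γ₀ j x) →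
      D.βfun k (clampPrefix D.βfun γ₀ k x) ≤ B)
    (hrun : ∀ (n : ℕ) (gs : ℕ → ℝ), RGEqH n D.βfun gs → Step.InInterval γ₀ n gs →
      ∀ k, k ≤ n → -M ≤ ∑ j ∈ Finset.Ico k n, D.βfun j (prefixOf gs j))
    (hNE : T4ApexHybrid.HybridNE7Under D (EndpointExistence D.C.toB12)) :
    ContinuumYM4Torus D ∧ ContinuumYM4TorusE D :=
  continuumYM4_torus_of_endpointExistence_nonvacuous D hD hB
    (endpointExistence_datum_of_survivorLetters_runwisePS D hγ₀ hM hsc hsl hrun) hNE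

/-- **THE SAME ON THE ORDER ROAD**: (B), `HaltsOutside`, survivor continuity + per-level survivor bounds + `hord` + TOP-RUNS of `D.βfun`, the
spine slot ⟹ `ContinuumYM4Torus D ∧ ContinuumYM4TorusE D`. [cite: Balaban1987RG1, Thm 2 p.259] -/
theorem continuumYM4_torus_of_survivorLetters_topRuns (D : FiniteEpsData F (Matrix.specialUnitaryGroup (Fin N) ℂ))
    (hD : D.IsPrintedAveraged) (hB : B16.EndStatementBPrinted D.C) (hhalt : HaltsOutside D.C.toB12 D.βfun) {γ₀ : ℝ} (hγ₀ : 0 < γ₀)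
    (hsc : ∀ k : ℕ, ContinuousOn (fun x : ℝ => D.βfun k (clampPrefix D.βfun γ₀ k x))
      {x : ℝ | 0 < x ∧ x ≤ γ₀ ∧ ∀ j, j ≤ k → 1 / γ₀ ^ 2 ≤ Y D.βfun γ₀ j x})
    (hsl : ∀ k : ℕ, ∃ B : ℝ, ∀ x : ℝ, 0 < x → x ≤ γ₀ → (∀ j, j ≤ k → 1 / γ₀ ^ 2 ≤ Y D.βfun γ₀ j x) →
      D.βfun k (clampPrefix D.βfun γ₀ k x) ≤ B)
    (hord : ∀ γ : ℝ, 0 < γ → γ ≤ γ₀ → ∀ (n : ℕ) (gs gs' : ℕ → ℝ), RGEqH n D.βfun gs → RGEqH n D.βfun gs' →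
      Step.InInterval γ n gs → Step.InInterval γ n gs' → gs 0 < gs' 0 → ∀ k, k ≤ n → gs k < gs' k)
    (htop : ∃ γ₂ : ℝ, 0 < γ₂ ∧ ∀ γ : ℝ, 0 < γ → γ ≤ γ₂ → ∃ gstar : ℝ, 0 < gstar ∧
        ∀ (n : ℕ) (gs : ℕ → ℝ), RGEqH n D.βfun gs → Step.InInterval γ n gs → ∀ k, k ≤ n → gs k = γ → gstar ≤ gs n)
    (hNE : T4ApexHybrid.HybridNE7Under D (EndpointExistence D.C.toB12)) :
    ContinuumYM4Torus D ∧ ContinuumYM4TorusE D :=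
  continuumYM4_torus_of_endpointExistence_nonvacuous D hD hB
    ((endpointExistence_datum_iff_topRuns_survivors D hhalt hγ₀ hsc hsl hord).mpr htop) hNE

end DatumSU

end

end Summit.QuantumFields.BalabanUV.Gaps.EndSurvivorCensus
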